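import Summits.Schanuel.Schanuel.Theses.RoyCriterion
import Literature.NumberTheory.Transcendental.RoySmallValueMain
import Summits.Schanuel.Schanuel.Theorems.RoySmallValueDirichletGap.Negative.GapReduction
import Summits.Schanuel.Schanuel.Theorems.RoySmallValueDirichletGap.Negative.EtaNeZeroFalse
import Summits.Schanuel.Schanuel.Theorems.RoySmallValueDirichletGap.Negative.TauLtOneAndCountLeDegreeFalse
import Summits.Schanuel.Schanuel.Theorems.RoySmallValueDirichletGap.Negative.DirichletEdge
import Summits.Schanuel.Schanuel.Theorems.RoySmallValueDirichletGap.Negative.FrequentlyFalse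

/-!
# Line `two-sided-absorption-transfer` — crux `RoySmallValueDirichletGap` (item stmt-Schanuel-1050)
# Skeleton v2 (lead `prover-line-stmt-Schanuel-1050-0`, 2026-08-16; reshape of the planner's v1)

Crux (route `RoyCriterion`): `Summit.Schanuel.Schanuel.Theses.RoyCriterion.RoySmallValueDirichletGap`
= Roy 2013 (Mathematika 59 = arXiv:1301.0663) Thm 1.1 with `ν` pushed down to the Dirichlet edge
`2 + β − τ`; open content (landed `…Gap.roySmallValueDirichletGap_iff_gap`): `1 < τ < 2`, `β > τ`,
`0 < δ := ν − (2 + β − τ) ≤ δ_R := (τ−1)(2−τ)/(β+1−τ)`.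

## Reshape v2 (lead) w.r.t. the planner's v1 (`Lines/two-sided-absorption-transfer.lean` @abc3f4fe)

* CURRENCY: a link is a finite set `P ⊂ ℂ³` of algebraic points (the complex points of Roy's enemy
  `Z_D`) with a height PARAMETER `h` obeying Liouville's inequality (Roy's Prop. 2.4) for every
  integer form — Roy's own currency (0-cycle, `deg Z = #P`, `h(Z) = h`) — instead of v1's
  `(K, a ∈ K³, σ : K →+* ℂ)`.  Reason: v1's size clause `[K:ℚ] ≤ C (D*)^{2−τ}` forces the field of
  DEFINITION `ℚ(a)` (the tree presents enemies over the much larger normal field `closureField S`),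
  i.e. a descent-of-embeddings bridge; and v1's Step 4 at a general presenting field needs uniform
  fibres of `σ ↦ σ∘a` (orbit–stabiliser).  In the 0-cycle currency the bridge is `Finset.image Z.α`
  and Step 4 at any level is the tree's glue `step4_sum_max_ge'` verbatim.  `TangentialTowerEmptiness`
  keeps its meaning (it quantifies over MORE objects than v1, so it is formally stronger; every
  clause is a property Roy proves of `Z_D`).
* STUB 1 of v1 (`stub_enemyLinks`, size L) is CUT IN TWO registered stubs: `stub_enemyOrbits`
  (Roy Steps 1–4 in the tree's own objects = `RoySmallValueMain.lean` ll. 70–685 minus `endgame`,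
  restructured from "for every `N` a level `D ≥ N`" to "every large `D`") and `stub_linksOfOrbits`
  (orbit currency ⇒ link currency).  Total 5 stubs ≤ stubs_max.
* The vocabulary and two elementary facts (`IsLink.combined` = Roy's Step 5 partition run on a
  link, `IsLink.rpow_Ds_le` = `endgame_step` (ii)) are proposed as the Defs file
  `Theorems/RoyCriterionRoySmallValueDirichletGapDefs.lean` (identical text to §0 below; this
  skeleton inlines it until that file lands, then imports it).

## The line, in one paragraph

(i) `stub_enemyOrbits` + `stub_linksOfOrbits` EXPOSE Roy's enemy at every large level as a link
(`HasLinks`); (ii) `stub_twoSidedAbsorption` proves the card's lever: every integer point of Roy's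
body `𝒞_{D'}` vanishes on the level-`D` link for ALL `D'` in `[D^{1−δ/(τ−1)}/c, c·D^{1+δ/β}]`;
(iii) `stub_royRegime` CALIBRATES: for `δ > δ_R` the link clauses alone are contradictory (Roy's
Step 5 = `IsLink.combined` + `Roy2013.endgame`); (iv) `stub_tangentialTowerEmptiness` (OPEN, the
lead's) says no transcendental `γ` carries two-sided absorbed links with `0 < δ ≤ δ_R`.
Composition `RoySmallValueDirichletGap_of` (sorry-free): `τ = 1` is Roy's theorem; for `1 < τ`,
`δ := ν − (2+β−τ) > 0`, assume `γ ∉ ℚ̄²`, get links (i); `δ > δ_R` absurd by (iii); else absorb (ii)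
and conclude by (iv).

## Disproof.lean (tree, gen2 v4.1) honoured / landed Negative lemmas (imported; §3 re-checks names)

`crux_iff_gapCase`/`crux_iff_nearEdge`: no stub is a ν-window — TTE is ν-free, the calibration stub
is exactly the complement `δ > δ_R`; `crux_false_without_etaNeZero`: `η ≠ 0` enters `stub_enemyOrbits`
(chart lemma `ZeroConfigK.chart_of_mem_orb`) and TTE; `crux_false_without_oneLeTau` /
`not_cruxC_of_count_le_degree`: every stub has `1 < τ`, the full count `3⌊D^τ⌋` enters
`stub_enemyOrbits` through Step 1, `τ = 1` is Roy's theorem in the composition; §4 `dirichletEdge`: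
every clause carries `D^δ`, `δ > 0`; §5 Thue–Siegel at `(0,p/q)`: algebraic point, TTE trivial
there; §6 `not_cruxFrequently`: `HasLinks`/`HasAbsorbedLinks` are `∀ᶠ D` statements.
`-- Targets` of Disproof: none yet (no stuck stubs published before this skeleton).
-/

-- `Summit.Schanuel.Schanuel.…` is the mandated layout of this single-problem summit (CONVENTIONS §1).
set_option linter.dupNamespace false

noncomputable section

set_option linter.unusedVariables false

namespace Summit.Schanuel.Schanuel.Theorems.RoyLinks

open Filter MvPolynomial Finset Height
open Literature.NumberTheory.Transcendental
open Literature.NumberTheory.Transcendental.Roy2013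
open Summit.Schanuel.Schanuel.Theses.RoyCriterion (RoySmallValueDirichletGap)

/-! ## §0 Vocabulary (= the proposed Defs file `Theorems/RoyCriterionRoySmallValueDirichletGapDefs.lean`, verbatim) -/

/-! ### The hypothesis of the crux -/

/-- The small-value hypothesis of the crux at `(ξ, η)` with exponents `(β, τ, ν)`: for every large
`D` a non-zero `P ∈ ℤ[X₁,X₂]` of degree `≤ D`, height `≤ e^{D^β}`, with `|𝒟₁ⁱP(ξ,η)| ≤ e^{−D^ν}` for
`i < 3⌊D^τ⌋`.  Verbatim the sub-formula of `RoySmallValueDirichletGap`.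
[cite: Roy2013, Theorem 1.1 (hypothesis)] -/
def SmallValueHyp (ξ η : ℂ) (β τ ν : ℝ) : Prop :=
  ∀ᶠ D : ℕ in atTop, ∃ P : MvPolynomial (Fin 2) ℤ, P ≠ 0 ∧ P.totalDegree ≤ D ∧
    (mvPolyHeight P : ℝ) ≤ Real.exp ((D : ℝ) ^ β) ∧
    ∀ i : ℕ, i < 3 * ⌊(D : ℝ) ^ τ⌋₊ →
      ‖MvPolynomial.aeval ![ξ, η] (royD^[i] P)‖ ≤ Real.exp (-(D : ℝ) ^ ν)

/-- READ-BACK: the crux verbatim in terms of `SmallValueHyp`. -/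
theorem roySmallValueDirichletGap_iff : RoySmallValueDirichletGap ↔
    ∀ (ξ η : ℂ), η ≠ 0 → ∀ (β τ ν : ℝ), 1 ≤ τ → τ < 2 → τ < β → 2 + β - τ < ν →
      SmallValueHyp ξ η β τ ν → IsAlgebraic ℚ ξ ∧ IsAlgebraic ℚ η := Iff.rfl

/-! ## Closeness to the point and to the leaf -/

/-- **Roy's closeness of a point to `(1:γ)` and to the leaf `A_γ` at depth `T`**:
`max{T·log dist(ᾱ,(1:γ)), log dist(ᾱ, A_γ)}` on the sup-normalised representative `ᾱ`
(tree `pdist`, `adist`, `supNormalise`; the `if` is the tree's convention for `dist(ᾱ, A_γ) = 0`).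
At `T = ⌊D^τ⌋` this is VERBATIM the summand of the tree's Step-2 inequality (`LevelPkg.step2_level`)
and, with `b` the `else` branch at depth `T`, of its Step 4 (`ZeroConfigK.step4_orbit`).
[cite: Roy2013, §7, Steps 2 and 4] -/
def leafCloseness (ξ η : ℂ) (T : ℕ) (α : Fin 3 → ℂ) : ℝ :=
  max (T * Real.log (pdist ξ η (supNormalise α)))
    (if 0 < adist ξ η (supNormalise α) then Real.log (adist ξ η (supNormalise α))
      else T * Real.log (pdist ξ η (supNormalise α)))

/-- Membership in Roy's set `𝒰` of points at projective distance `≤ (2c₂)⁻¹` from `(1:γ)`.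
[cite: Roy2013, §7, Step 2 (definition of `𝒰`)] -/
def IsNear (ξ η : ℂ) (α : Fin 3 → ℂ) : Prop :=
  pdist ξ η (supNormalise α) ≤ (2 * roy_c2 ξ η)⁻¹

/-- `IsNear` is a real inequality, hence decidable (classically, as `≤` on `ℝ`); this named instance
only unfolds the definition so that `Finset.filter (IsNear ξ η)` elaborates. -/
instance IsNear.decidable (ξ η : ℂ) : DecidablePred (IsNear ξ η) :=
  fun α => inferInstanceAs (Decidable (pdist ξ η (supNormalise α) ≤ (2 * roy_c2 ξ η)⁻¹))

/-- Unfolding lemma for `IsNear`. -/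
theorem isNear_iff (ξ η : ℂ) (α : Fin 3 → ℂ) :
    IsNear ξ η α ↔ pdist ξ η (supNormalise α) ≤ (2 * roy_c2 ξ η)⁻¹ := Iff.rfl

/-- A near point has `log dist(ᾱ,(1:γ)) ≤ 0` (indeed `dist ≤ (2c₂)⁻¹ ≤ 1/2`). [cite: Roy2013, §7, Step 2] -/
theorem log_pdist_nonpos_of_isNear {ξ η : ℂ} {α : Fin 3 → ℂ} (h : IsNear ξ η α) :
    Real.log (pdist ξ η (supNormalise α)) ≤ 0 := by
  have hc := one_le_roy_c2 ξ η
  have h1 : (2 * roy_c2 ξ η)⁻¹ ≤ 1 := by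
    rw [inv_le_one_iff₀]; right; linarith
  exact Real.log_nonpos (pdist_nonneg _ _ _) (h.trans h1)

/-! ## The link currency -/

/-- **An enemy link at level `D` with constant `C`** — Roy's enemy `Z_D` as a 0-cycle: a finite set
`P ⊂ ℂ³` of representatives (the complex points of `Z_D`), a height parameter `h` and a level `D*`,
with: (chart) `p₀ ≠ 0`; (alg) all coordinates algebraic; (pos) no point is `(1:γ)`; `P ≠ ∅`;
`1 ≤ D* < D`; (size, Step 3) `#P ≤ C (D*)^{2−τ}`, `0 ≤ h ≤ C (D*)^{1+β−τ}`;
(Liouville, Prop. 2.4) for every integer form `R` of degree `D'` not vanishing at some point of `P`: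
`R` vanishes at no point of `P` and `0 ≤ D' h + ∑_{p∈P} log(|R(p)|/‖p‖^{D'})`;
(mass, Step 2) `∑_{p ∈ P ∩ 𝒰} max{T log dist(p̄,(1:γ)), log dist(p̄, A_γ)} ≤ −(D^δ/C)(D^β #P + D h)`,
`T = ⌊D^τ⌋`; (Step 4 at `D*`) for every `𝒮 ⊆ P ∩ 𝒰`,
`∑_{p∈𝒮} max{T* log dist, log dist_A} ≥ −C((D*)^β #P + D* h)`, `T* = ⌊(D*)^τ⌋`.
For a Galois orbit, `h = #P ·` (absolute logarithmic Weil height) serves (`stub_linksOfOrbits`);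
tree constants `C = max(1280, 74·2^{1+β−τ})` serve (`stub_enemyOrbits`).
[cite: Roy2013, §7, Steps 2–4 (pp. 18–19); Prop. 2.4] -/
def IsLink (C : ℝ) (ξ η : ℂ) (β τ δ : ℝ) (D : ℕ) (P : Finset (Fin 3 → ℂ)) (h : ℝ) (Ds : ℕ) : Prop :=
  (∀ p ∈ P, p 0 ≠ 0) ∧
  (∀ p ∈ P, ∀ k, IsAlgebraic ℚ (p k)) ∧
  (∀ p ∈ P, 0 < pdist ξ η (supNormalise p)) ∧
  P.Nonempty ∧ 1 ≤ Ds ∧ Ds < D ∧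
  (P.card : ℝ) ≤ C * (Ds : ℝ) ^ (2 - τ) ∧
  0 ≤ h ∧ h ≤ C * (Ds : ℝ) ^ (1 + β - τ) ∧
  (∀ (D' : ℕ) (R : MvPolynomial (Fin 3) ℤ), R.IsHomogeneous D' →
      (∃ p ∈ P, MvPolynomial.aeval p R ≠ 0) →
      (∀ p ∈ P, MvPolynomial.aeval p R ≠ 0) ∧
        0 ≤ D' * h + ∑ p ∈ P, Real.log (‖MvPolynomial.aeval p R‖ / ‖p‖ ^ D')) ∧
  (∑ p ∈ P.filter (IsNear ξ η), leafCloseness ξ η ⌊(D : ℝ) ^ τ⌋₊ p) ≤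
      -((D : ℝ) ^ δ / C * ((D : ℝ) ^ β * P.card + D * h)) ∧
  (∀ S ⊆ P.filter (IsNear ξ η),
      -(C * ((Ds : ℝ) ^ β * P.card + Ds * h)) ≤ ∑ p ∈ S, leafCloseness ξ η ⌊(Ds : ℝ) ^ τ⌋₊ p)

/-- **`γ` carries enemy links**: for some constant `C > 0`, at every large level `D` there is an
enemy link. [cite: Roy2013, §7 (the output of Steps 1–4 before Step 5)] -/
def HasLinks (ξ η : ℂ) (β τ δ : ℝ) : Prop :=
  ∃ C : ℝ, 0 < C ∧ ∀ᶠ D : ℕ in atTop,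
    ∃ (P : Finset (Fin 3 → ℂ)) (h : ℝ) (Ds : ℕ), IsLink C ξ η β τ δ D P h Ds

/-- **Absorption at level `D'`**: every INTEGER point of Roy's body
`𝒞_{D'} = {R ∈ ℂ[X]_{D'} : ‖R‖ ≤ e^{2D'^β}, |𝒟ⁱR(1,γ)| ≤ e^{−D'^ν/2} (i < ⌊D'^τ⌋)}`, `ν = 2+β−τ+δ`
(tree `royBody`), vanishes at every point of `P`.
[cite: Roy2013, §7, Step 1 (the body `𝒞_D`) and Prop. 2.3 (2.2)] -/
def Absorbs (ξ η : ℂ) (β τ δ : ℝ) (D' : ℕ) (P : Finset (Fin 3 → ℂ)) : Prop :=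
  ∀ R : MvPolynomial (Fin 3) ℤ, R.IsHomogeneous D' →
    MvPolynomial.map (Int.castRingHom ℂ) R ∈
      royBody D' ξ η (2 * (D' : ℝ) ^ β) ((D' : ℝ) ^ (2 + β - τ + δ) / 2) ⌊(D' : ℝ) ^ τ⌋₊ →
    ∀ p ∈ P, MvPolynomial.aeval p R = 0

/-- **`γ` carries TWO-SIDED ABSORBED enemy links**: links (constant `C`) that are moreover absorbed
at every level `D'` of the two-sided range `D^{1−δ/(τ−1)}/c ≤ D' ≤ c·D^{1+δ/β}` (constant `c > 0`).
This is the hypothesis of the open stub (the card's "tangential tower", with the card's lever built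
in). [cite: Roy2013, §7; this notion: card two-sided-absorption-transfer, F2/F7] -/
def HasAbsorbedLinks (ξ η : ℂ) (β τ δ : ℝ) : Prop :=
  ∃ C c : ℝ, 0 < C ∧ 0 < c ∧ ∀ᶠ D : ℕ in atTop,
    ∃ (P : Finset (Fin 3 → ℂ)) (h : ℝ) (Ds : ℕ), IsLink C ξ η β τ δ D P h Ds ∧
      ∀ D' : ℕ, (D : ℝ) ^ (1 - δ / (τ - 1)) / c ≤ D' → (D' : ℝ) ≤ c * (D : ℝ) ^ (1 + δ / β) →
        Absorbs ξ η β τ δ D' P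

/-- **TANGENTIAL TOWER EMPTINESS in the gap** (the line's open residual, transfer `C⁺` of the card):
no point `(ξ, η) ∈ ℂ × ℂˣ` outside `ℚ̄²` carries two-sided absorbed enemy links with exponents
`1 < τ < 2`, `β > τ`, `0 < δ ≤ δ_R = (τ−1)(2−τ)/(β+1−τ)`.  Polynomial-free on the hypothesis side,
ν-free, pair-free; stronger than the crux's open content (via the registered stubs).  OPEN.
[cite: Roy2013, §7 Step 5 (the un-excluded regime `δ ≤ δ_R`); card two-sided-absorption-transfer, F7] -/
def TangentialTowerEmptiness : Prop :=
  ∀ (ξ η : ℂ), η ≠ 0 → ∀ (β τ δ : ℝ), 1 < τ → τ < 2 → τ < β → 0 < δ →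
    δ ≤ (τ - 1) * (2 - τ) / (β + 1 - τ) →
    HasAbsorbedLinks ξ η β τ δ → IsAlgebraic ℚ ξ ∧ IsAlgebraic ℚ η

/-! ## The orbit currency (the tree's objects) -/

/-- **The height of an orbit** `h(O) = ∑_{j∈O} h_K(rep j) / [K:ℚ]` of a configuration of zeros over
the number field `K` (`h_K` = Mathlib's relative logarithmic Weil height `Height.logHeight`).
[cite: Roy2013, §2 (height of a 0-cycle); §7, Step 3] -/
def orbitHeight {K : IntermediateField ℚ ℂ} [NumberField K] {ι : Type*} [Fintype ι] [DecidableEq ι]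
    (Z : ZeroConfigK K ι) (j₀ : ι) : ℝ :=
  (∑ j ∈ Z.orb j₀, logHeight (Z.rep j)) / Module.finrank ℚ K

/-- **An enemy link in the orbit currency**: the clauses of `IsLink` (chart, pos, levels, size, mass,
Step 4) for the orbit `O = Z.orb j₀` of a configuration of zeros `Z` over a number field, with
`#P ↦ #O` and `h ↦ h(O) = orbitHeight Z j₀` (algebraicity and Liouville are then automatic:
`ZeroConfigK.orbit_liouville_log'`).  This is exactly what `RoySmallValueMain.lean` hands to
`Roy2013.endgame`, one level at a time. [cite: Roy2013, §7, Steps 2–4] -/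
def IsOrbitLink (C : ℝ) (ξ η : ℂ) (β τ δ : ℝ) (D : ℕ) {K : IntermediateField ℚ ℂ} [NumberField K]
    {ι : Type*} [Fintype ι] [DecidableEq ι] (Z : ZeroConfigK K ι) (j₀ : ι) (Ds : ℕ) : Prop :=
  (∀ j ∈ Z.orb j₀, Z.α j 0 ≠ 0) ∧
  (∀ j ∈ Z.orb j₀, 0 < pdist ξ η (supNormalise (Z.α j))) ∧
  1 ≤ Ds ∧ Ds < D ∧
  ((Z.orb j₀).card : ℝ) ≤ C * (Ds : ℝ) ^ (2 - τ) ∧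
  orbitHeight Z j₀ ≤ C * (Ds : ℝ) ^ (1 + β - τ) ∧
  (∑ j ∈ (Z.orb j₀).filter (fun j => IsNear ξ η (Z.α j)), leafCloseness ξ η ⌊(D : ℝ) ^ τ⌋₊ (Z.α j)) ≤
      -((D : ℝ) ^ δ / C * ((D : ℝ) ^ β * (Z.orb j₀).card + D * orbitHeight Z j₀)) ∧
  (∀ S ⊆ (Z.orb j₀).filter (fun j => IsNear ξ η (Z.α j)),
      -(C * ((Ds : ℝ) ^ β * (Z.orb j₀).card + Ds * orbitHeight Z j₀)) ≤
        ∑ j ∈ S, leafCloseness ξ η ⌊(Ds : ℝ) ^ τ⌋₊ (Z.α j))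

/-- **`γ` carries enemy links in the orbit currency**: for some `C > 0`, at every large level `D`
there are a finite set `S` of algebraic numbers, a configuration of zeros `Z` over the normal number
field `closureField S` indexed by `Fin m`, an index `j₀` and a level `D*` forming an orbit link.
[cite: Roy2013, §7, Steps 1–4] -/
def HasOrbitLinks (ξ η : ℂ) (β τ δ : ℝ) : Prop :=
  ∃ C : ℝ, 0 < C ∧ ∀ᶠ D : ℕ in atTop,
    ∃ (S : Finset ℂ) (m : ℕ) (Z : ZeroConfigK (closureField S) (Fin m)) (j₀ : Fin m) (Ds : ℕ),
      IsOrbitLink C ξ η β τ δ D Z j₀ Ds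

/-! ## Elementary facts about links -/

namespace IsLink

variable {C : ℝ} {ξ η : ℂ} {β τ δ : ℝ} {D : ℕ} {P : Finset (Fin 3 → ℂ)} {h : ℝ} {Ds : ℕ}

/-- A link has at least one point. -/
theorem one_le_card (hL : IsLink C ξ η β τ δ D P h Ds) : (1 : ℝ) ≤ P.card := by
  exact_mod_cast hL.2.2.2.1.card_pos

/-- The constant of a link is positive (the size clause and `P ≠ ∅`). -/
theorem const_pos (hL : IsLink C ξ η β τ δ D P h Ds) : 0 < C := by
  have h1 := hL.one_le_card
  have h2 := hL.2.2.2.2.2.2.1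
  have hDs : (0 : ℝ) < (Ds : ℝ) ^ (2 - τ) := by
    have : (1 : ℝ) ≤ Ds := by exact_mod_cast hL.2.2.2.2.1
    exact Real.rpow_pos_of_pos (by linarith) _
  by_contra hC
  push Not at hC
  have : C * (Ds : ℝ) ^ (2 - τ) ≤ 0 := mul_nonpos_of_nonpos_of_nonneg hC hDs.le
  linarith

/-- **Monotonicity in the constant**: a link with constant `C` is a link with any `C' ≥ C`. -/
theorem mono (hL : IsLink C ξ η β τ δ D P h Ds) {C' : ℝ} (hCC' : C ≤ C') :
    IsLink C' ξ η β τ δ D P h Ds := by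
  obtain ⟨hch, halg, hpos, hne, hDs1, hDsD, hcard, hh0, hh, hLiou, hmass, hstep4⟩ := hL
  have hC : 0 < C := IsLink.const_pos ⟨hch, halg, hpos, hne, hDs1, hDsD, hcard, hh0, hh, hLiou, hmass, hstep4⟩
  have hx : (0 : ℝ) ≤ Ds := Nat.cast_nonneg _
  have hxD : (0 : ℝ) ≤ D := Nat.cast_nonneg _
  have hd0 : (0 : ℝ) ≤ P.card := Nat.cast_nonneg _
  refine ⟨hch, halg, hpos, hne, hDs1, hDsD, ?_, hh0, ?_, hLiou, ?_, ?_⟩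
  · exact hcard.trans (mul_le_mul_of_nonneg_right hCC' (Real.rpow_nonneg hx _))
  · exact hh.trans (mul_le_mul_of_nonneg_right hCC' (Real.rpow_nonneg hx _))
  · refine hmass.trans ?_
    have hbr : 0 ≤ (D : ℝ) ^ β * P.card + D * h :=
      add_nonneg (mul_nonneg (Real.rpow_nonneg hxD _) hd0) (mul_nonneg hxD hh0)
    have hδ0 : 0 ≤ (D : ℝ) ^ δ := Real.rpow_nonneg hxD _
    have : (D : ℝ) ^ δ / C' * ((D : ℝ) ^ β * P.card + D * h) ≤
        (D : ℝ) ^ δ / C * ((D : ℝ) ^ β * P.card + D * h) :=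
      mul_le_mul_of_nonneg_right (div_le_div_of_nonneg_left hδ0 hC hCC') hbr
    linarith
  · intro S hS
    refine le_trans ?_ (hstep4 S hS)
    have hbr : 0 ≤ (Ds : ℝ) ^ β * P.card + Ds * h :=
      add_nonneg (mul_nonneg (Real.rpow_nonneg hx _) hd0) (mul_nonneg hx hh0)
    have := mul_le_mul_of_nonneg_right hCC' hbr
    linarith

/-- **Roy 2013, §7, Step 5, "combining these three inequalities"**, run on a link: the mass clause
(depth `T = ⌊D^τ⌋`) and the Step-4 clause (depth `T* = ⌊(D*)^τ⌋`, all subsets of `P ∩ 𝒰`) give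
`(D^δ/C)(D^β #P + D h) ≤ (T/T* + 1) · C((D*)^β #P + D* h)` (the tree's partition lemma
`Roy2013.le_ratio_add_one_mul` with `aₚ = log dist(p̄,(1:γ))`, `bₚ` = the second coordinate of
`leafCloseness` at depth `T*`).  [cite: Roy2013, §7, Step 5 (first display)] -/
theorem combined (hL : IsLink C ξ η β τ δ D P h Ds) (hτ : 0 ≤ τ) :
    (D : ℝ) ^ δ / C * ((D : ℝ) ^ β * P.card + D * h) ≤
      ((⌊(D : ℝ) ^ τ⌋₊ : ℝ) / ⌊(Ds : ℝ) ^ τ⌋₊ + 1) * (C * ((Ds : ℝ) ^ β * P.card + Ds * h)) := by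
  obtain ⟨-, -, -, -, hDs1, hDsD, -, -, -, -, hmass, hstep4⟩ := hL
  set U := P.filter (IsNear ξ η) with hU
  set T : ℕ := ⌊(D : ℝ) ^ τ⌋₊ with hT
  set Ts : ℕ := ⌊(Ds : ℝ) ^ τ⌋₊ with hTs
  -- `T* ≥ 1` and `T* ≤ T`
  have hTs1 : 1 ≤ Ts := one_le_natFloor_rpow hDs1 hτ
  have hTsT : Ts ≤ T := by
    apply Nat.floor_le_floor
    exact Real.rpow_le_rpow (Nat.cast_nonneg _) (by exact_mod_cast hDsD.le) hτ
  -- the two coordinates (`b` = the second coordinate of `leafCloseness` at depth `T`)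
  set a : (Fin 3 → ℂ) → ℝ := fun p => Real.log (pdist ξ η (supNormalise p)) with ha
  set b : (Fin 3 → ℂ) → ℝ := fun p =>
    if 0 < adist ξ η (supNormalise p) then Real.log (adist ξ η (supNormalise p))
    else T * Real.log (pdist ξ η (supNormalise p)) with hb
  -- depth `T`: `leafCloseness T p = max (T aₚ) bₚ` literally
  have hT_eq : ∀ p, leafCloseness ξ η T p = max ((T : ℝ) * a p) (b p) := fun p => rfl
  -- depth `T*`: `leafCloseness T* p = max (T* aₚ) bₚ` on near points (`aₚ ≤ 0`, `T* ≤ T`)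
  have hTs_eq : ∀ p ∈ U, leafCloseness ξ η Ts p = max ((Ts : ℝ) * a p) (b p) := by
    intro p hp
    have hnear : IsNear ξ η p := (mem_filter.mp hp).2
    have ha0 : a p ≤ 0 := log_pdist_nonpos_of_isNear hnear
    simp only [leafCloseness, hb, ha]
    split_ifs with hq
    · rfl
    · have hTT : (Ts : ℝ) ≤ T := by exact_mod_cast hTsT
      have h1 : (T : ℝ) * Real.log (pdist ξ η (supNormalise p)) ≤
          Ts * Real.log (pdist ξ η (supNormalise p)) := by
        have := mul_le_mul_of_nonpos_right hTT ha0
        simpa [ha] using this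
      rw [max_self, max_eq_left h1]
  have h2 : ∑ p ∈ U, max ((T : ℝ) * a p) (b p) ≤
      -((D : ℝ) ^ δ / C * ((D : ℝ) ^ β * P.card + D * h)) := by
    calc ∑ p ∈ U, max ((T : ℝ) * a p) (b p) = ∑ p ∈ U, leafCloseness ξ η T p :=
          sum_congr rfl fun p _ => (hT_eq p).symm
      _ ≤ _ := hmass
  have h4 : ∀ S ⊆ U, -(C * ((Ds : ℝ) ^ β * P.card + Ds * h)) ≤
      ∑ p ∈ S, max ((Ts : ℝ) * a p) (b p) := by
    intro S hS
    calc -(C * ((Ds : ℝ) ^ β * P.card + Ds * h)) ≤ ∑ p ∈ S, leafCloseness ξ η Ts p := hstep4 S hS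
      _ = ∑ p ∈ S, max ((Ts : ℝ) * a p) (b p) := sum_congr rfl fun p hp => hTs_eq p (hS hp)
  exact le_ratio_add_one_mul U a b (Nat.cast_nonneg T) (by exact_mod_cast hTs1) h2 h4

/-- **Roy 2013, §7, Step 5 (ii), run on a link**: for `1 ≤ τ ≤ β`, `C ≥ 1` and `D^δ ≥ 6C³`,
`(D*)^{τ−1} ≤ 3C² · D^{τ−1−δ}` — the tree's `Roy2013.endgame_step` (first conclusion) on
`IsLink.combined`, with `κ = 1/C²`, `A = C`, `A₃ = C²`, `d = #P`, `h(Z) = C·h`.  In particular a link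
of level `D` is born at a level `D* ≤ (3C²)^{1/(τ−1)} D^{1−δ/(τ−1)}` (for `τ > 1`; first raise the
constant to `max C 1` by `IsLink.mono`).  [cite: Roy2013, §7, Step 5] -/
theorem rpow_Ds_le (hL : IsLink C ξ η β τ δ D P h Ds) (hτ1 : 1 ≤ τ) (hτβ : τ ≤ β) (hC1 : 1 ≤ C)
    (hlarge : 6 * C ^ 3 ≤ (D : ℝ) ^ δ) :
    (Ds : ℝ) ^ (τ - 1) ≤ 3 * C ^ 2 * (D : ℝ) ^ (τ - 1 - δ) := by
  have hC : 0 < C := hL.const_pos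
  have hcomb := hL.combined (by linarith)
  obtain ⟨-, -, -, hne, hDs1, hDsD, -, hh0, hh, -, -, -⟩ := hL
  have hd1 : (1 : ℝ) ≤ P.card := by exact_mod_cast hne.card_pos
  have hd0 : (0 : ℝ) ≤ P.card := by linarith
  have hDs1r : (1 : ℝ) ≤ Ds := by exact_mod_cast hDs1
  have hDsDr : (Ds : ℝ) ≤ D := by exact_mod_cast hDsD.le
  have hD1 : (1 : ℝ) ≤ D := hDs1r.trans hDsDr
  have hτ0 : 0 ≤ τ := by linarith
  have hT : ((⌊(D : ℝ) ^ τ⌋₊ : ℕ) : ℝ) ≤ (D : ℝ) ^ τ := natFloor_rpow_le D τ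
  have hTs : (0 : ℝ) < (⌊(Ds : ℝ) ^ τ⌋₊ : ℕ) := by exact_mod_cast one_le_natFloor_rpow hDs1 hτ0
  have hTs2 : (Ds : ℝ) ^ τ ≤ 2 * (⌊(Ds : ℝ) ^ τ⌋₊ : ℕ) := rpow_le_two_mul_natFloor hDs1 hτ0
  have hκ : (0 : ℝ) < 1 / C ^ 2 := by positivity
  have hDδ : (0 : ℝ) ≤ (D : ℝ) ^ δ := Real.rpow_nonneg (by linarith) _
  have hDβ : (0 : ℝ) ≤ (D : ℝ) ^ β := Real.rpow_nonneg (by linarith) _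
  have hineq : 1 / C ^ 2 * (D : ℝ) ^ δ * ((D : ℝ) ^ β * P.card + D * (C * h)) ≤
      ((⌊(D : ℝ) ^ τ⌋₊ : ℝ) / ⌊(Ds : ℝ) ^ τ⌋₊ + 1) * (C * (Ds : ℝ) ^ β * P.card + Ds * (C * h)) := by
    have e2 : C * (Ds : ℝ) ^ β * P.card + Ds * (C * h) = C * ((Ds : ℝ) ^ β * P.card + Ds * h) := by ring
    rw [e2]
    refine le_trans ?_ hcomb
    -- `(1/C²) D^δ (D^β d + D C h) ≤ (1/C) D^δ (D^β d + D h)` as `C ≥ 1`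
    have hinv : 1 / C ^ 2 ≤ 1 / C := by
      rw [div_le_div_iff_of_pos_left one_pos (by positivity) hC]; nlinarith
    have t1 : 1 / C ^ 2 * (D : ℝ) ^ δ * ((D : ℝ) ^ β * P.card) ≤ 1 / C * (D : ℝ) ^ δ * ((D : ℝ) ^ β * P.card) :=
      mul_le_mul_of_nonneg_right (mul_le_mul_of_nonneg_right hinv hDδ) (mul_nonneg hDβ hd0)
    have t2 : 1 / C ^ 2 * (D : ℝ) ^ δ * (D * (C * h)) = 1 / C * (D : ℝ) ^ δ * (D * h) := by
      field_simp
    have e1 : (D : ℝ) ^ δ / C * ((D : ℝ) ^ β * P.card + D * h) =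
        1 / C * (D : ℝ) ^ δ * ((D : ℝ) ^ β * P.card) + 1 / C * (D : ℝ) ^ δ * (D * h) := by ring
    rw [e1, mul_add, t2]
    linarith
  have hlarge' : 6 * C ≤ 1 / C ^ 2 * (D : ℝ) ^ δ := by
    rw [one_div, ← div_eq_inv_mul, le_div_iff₀ (by positivity)]; nlinarith
  have hstep := endgame_step (τ := τ) (β := β) (δ := δ) (κ := 1 / C ^ 2) (A := C) (A₃ := C ^ 2)
    (D := (D : ℝ)) (Ds := (Ds : ℝ)) (d := (P.card : ℝ)) (h := C * h)
    (T := ((⌊(D : ℝ) ^ τ⌋₊ : ℕ) : ℝ)) (Ts := ((⌊(Ds : ℝ) ^ τ⌋₊ : ℕ) : ℝ))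
    hτ0 hτβ hκ hD1 hDs1r hDsDr hd1 (mul_nonneg hC.le hh0)
    (by have := mul_le_mul_of_nonneg_left hh hC.le; nlinarith) (Nat.cast_nonneg _) hT hTs hTs2
    hlarge' hineq
  have e : 3 / (1 / C ^ 2) * (D : ℝ) ^ (τ - 1 - δ) = 3 * C ^ 2 * (D : ℝ) ^ (τ - 1 - δ) := by
    field_simp
  rw [← e]; exact hstep.1

end IsLink


/-! ## §1 Registered stubs -/

/-- **STUB 1a — enemy orbits (Roy 2013 §7 Steps 1–4, EXPOSED in the tree's objects).**  Size L;
provable now (known).  At `(ξ, η)`, `η ≠ 0`, not in `ℚ̄²`, the small-value hypothesis with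
`1 < τ < 2`, `β > τ`, `ν = 2 + β − τ + δ`, `δ > 0` yields orbit links at EVERY large level `D`.
Proof = `Roy2013.roy2013_thm_1_1_holds` (RoySmallValueMain.lean ll. 70–685) with (a) the frame
`refine endgame … fun Nr => ?_; D := max ⌈Nr⌉ (max D₃ (D₁+2))` replaced by
`filter_upwards [eventually_ge_atTop (max D₃ (D₁ + 2))] with D hD` (everything after l. 213 is
per-`D`); (b) the call to `step45_combined` (l. 660) replaced by `ZeroConfigK.step4_orbit` for every
`𝒮 ⊆ 𝒰 ∩ O` with `b := the else-branch at depth T* = Tn Ds` (allowed: `hb` constrains only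
`adist > 0`), followed by the simplification `hR8` (ll. 665–678) and `#𝒮 ≤ #O`, `log(4·…) ≥ 0`
(as in `step45_combined` ll. 208–237), giving the Step-4 clause with constant `8 ≤ C`;
(c) the witnesses `S` (l. 246), `m := L.m`, `Z := L.cfg (closureField S) hK`, `j₀`, `Ds`; clauses:
chart = `hchart`, pos = `hd₁pos`, `1 ≤ Ds` = `hDs1`, `Ds < D` from `hDsD`, size = `hdle`
(`8 (D*)^{2−τ}`), height = `hhOle` (`A₃ = 74·2^{1+β−τ}`), mass = `hdist2` (`κ = 1/1280`);
`C := max 1280 (74·2^{1+β−τ})`.  Two files ≤ 400 lines (a per-level lemma, then the assembly).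
[cite: Roy2013, §7, Steps 1–4, pp. 18–19] -/
theorem stub_enemyOrbits (ξ η : ℂ) (hη : η ≠ 0) (hna : ¬(IsAlgebraic ℚ ξ ∧ IsAlgebraic ℚ η))
    (β τ δ : ℝ) (h1 : 1 < τ) (h2 : τ < 2) (hβ : τ < β) (hδ : 0 < δ)
    (hP : SmallValueHyp ξ η β τ (2 + β - τ + δ)) : HasOrbitLinks ξ η β τ δ := by
  sorry

/-- **STUB 1b — links of orbits (the currency bridge).**  Size M; provable now (known).
An orbit link gives a link with the same constant: `P := (Z.orb j₀).image Z.α` (`Z.α` is injective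
by `Z.sep`, so `#P = #O` and sums over `P` are sums over `O`: `Finset.sum_image`,
`Finset.card_image_of_injective`, `Finset.filter_image`), `h := orbitHeight Z j₀ ≥ 0`
(`Height.logHeight_nonneg`); chart/pos/levels/size/mass/Step-4 clauses are copied; (alg) the
coordinates lie in the number field `closureField S` (`Z.mem`, `Algebra.IsAlgebraic` of a
finite-dimensional intermediate field, `IntermediateField.isAlgebraic_iff`); (Liouville) from
`∃ p ∈ P, R(p) ≠ 0` get `j ∈ O` with `aeval (Z.α j) R ≠ 0`, hence `aeval (Z.rep j) R ≠ 0`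
(`ZeroConfigK.coe_aeval_rep_int`), then `ZeroConfigK.aeval_rep_ne_zero_of_mem_orb` (all of `O`,
using `Z.orb_eq_of_mem`) and `ZeroConfigK.orbit_liouville_log'` (`0 ≤ D' h(O) + ∑_{j∈O} log(|R(α_j)|/‖α_j‖^{D'})`).
[cite: Roy2013, Prop. 2.4; §7 Step 4 (first display)] -/
theorem stub_linksOfOrbits (ξ η : ℂ) (β τ δ : ℝ) :
    HasOrbitLinks ξ η β τ δ → HasLinks ξ η β τ δ := by
  sorry

/-- **STUB 2 — two-sided strong absorption (the card's lever F2; NEW as a statement).**  Size M;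
provable now.  For every constant `C` there is `c > 0` such that, for all large `D`, every link of
level `D` is absorbed at EVERY level `D'` with `D^{1−δ/(τ−1)}/c ≤ D' ≤ c·D^{1+δ/β}`.
Proof sketch (lead-checked): WLOG `C ≥ 1` (`IsLink.mono`).  Let `R ∈ ℤ[X]_{D'}`, `R ∈ 𝒞_{D'}`, and
suppose `R(p₁) ≠ 0` for some `p₁ ∈ P`.  (Liouville clause) `R(p) ≠ 0` on `P` and
`0 ≤ D' h + ∑_{p∈P} log yₚ`, `yₚ := |R(p)|/‖p‖^{D'} = |R(p̄)|` (`Roy2013.norm_eval_supNormalise`);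
(crude) `log yₚ ≤ D' log 3 + 2D'^β` (`Roy2013.norm_eval_le_of_mem_royBody`); (Prop. 4.2 at near
points) `yₚ ≤ e^{2c₂²} e^{−U'} + 3^{D'} e^{2D'^β} c₄^{D'} (dist^{T'} + dist_A)` (`Roy2013.prop_4_2`,
`lemma_4_1`, `exists_one_le_supNormalise`, `supNormalise_le_one`), `U' = D'^{2+β−τ+δ}/2`,
`T' = ⌊D'^τ⌋`; glue `Roy2013.step4_sum_max_ge'` with `O := P`,
`𝒮 := {p ∈ P ∩ 𝒰 : leafCloseness T p < 0}`, `b := else-branch at depth T'`: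
`∑_{p∈𝒮} leafCloseness T' p ≥ −(D' h + #P (D' log 3 + 2D'^β) + #𝒮 log(4·3^{D'} e^{2D'^β} c₄^{D'}))
 ≥ −(D' h + 6 #P D'^β)` eventually; its largeness hypothesis `hbig` holds because `D' ≥ D*`
(`IsLink.rpow_Ds_le`: `D* ≤ (3C²)^{1/(τ−1)} D^{1−δ/(τ−1)} ≤ D'` for `c ≤ (3C²)^{−1/(τ−1)}`) makes
`D' h + 3 #P D'^β ≤ 4C D'^{2+β−τ} ≪ U'`.  Mass side: on `𝒮` both coordinates are `< 0`, so
`leafCloseness T' ≤ (T'/T) leafCloseness T` for `T' ≤ T` and `≤ leafCloseness T` for `T' ≥ T`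
(`max_rescale_le` / `max_mono_depth` of the card's Sketch, 5-line lemmas to re-prove in file), and
`∑_𝒮 leafCloseness T ≤ ∑_{P∩𝒰} leafCloseness T ≤ −(D^δ/C)(D^β #P + D h)` (terms off `𝒮` are `≥ 0`).
Bookkeeping (= `SketchIdeator6.TwoSidedAbsorptionBookkeeping`, kernel-checked by triage r2-3): with
`T'/T ≥ (D'/D)^τ/2`, on `D ≤ D' ≤ cD^{1+δ/β}` and on `(4C)^{1/(τ−1)}·… ≤ D' ≤ D` each RHS term is
`≤ 1/2` of the matching LHS term for `c` small and `D` large, contradiction since `#P ≥ 1`.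
Why it might fail: only mis-scaled constants (all absorbed in `c` and "`D` large").
[cite: Roy2013, §7 Steps 2–5, Props 2.4, 4.2, Lemma 4.1; card F2; TRIAGE-r2-1 (Q1)] -/
theorem stub_twoSidedAbsorption (ξ η : ℂ) (β τ δ C : ℝ) (h1 : 1 < τ) (h2 : τ < 2)
    (hβ : τ < β) (hδ : 0 < δ) (hC : 0 < C) :
    ∃ c : ℝ, 0 < c ∧ ∀ᶠ D : ℕ in atTop,
      ∀ (P : Finset (Fin 3 → ℂ)) (h : ℝ) (Ds : ℕ), IsLink C ξ η β τ δ D P h Ds →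
        ∀ D' : ℕ, (D : ℝ) ^ (1 - δ / (τ - 1)) / c ≤ D' → (D' : ℝ) ≤ c * (D : ℝ) ^ (1 + δ / β) →
          Absorbs ξ η β τ δ D' P := by
  sorry

/-- **STUB 3 — calibration: Roy's regime in the link currency.**  Size S; provable now (known
algebra).  For `δ > δ_R = (τ−1)(2−τ)/(β+1−τ)` no point carries links: given `HasLinks` with
constant `C` (WLOG `C ≥ 1` by `IsLink.mono`), feed `Roy2013.endgame` (`κ := 1/C`, `A := C`,
`A₃ := C`) with, for every `N`, a level `D ≥ N` in the eventual range and the data `D* := Ds`,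
`d := #P ≥ 1`, `hZ := h`, `T := ⌊D^τ⌋ ≤ D^τ`, `T* := ⌊(D*)^τ⌋` (`1 ≤ T*`, `(D*)^τ ≤ 2T*`:
`Roy2013.one_le_natFloor_rpow`, `rpow_le_two_mul_natFloor`, `natFloor_rpow_le`) and the combined
inequality `IsLink.combined` (rewrite `D^δ/C·x = (1/C)·D^δ·x`, `C(a + b) = C a + … `).  This is
the line's CHEAPEST FALSIFIER of the currency.  [cite: Roy2013, §7, Step 5, p. 19] -/
theorem stub_royRegime (ξ η : ℂ) (β τ δ : ℝ) (h1 : 1 < τ) (h2 : τ < 2) (hβ : τ < β)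
    (hδR : (τ - 1) * (2 - τ) / (β + 1 - τ) < δ) : ¬HasLinks ξ η β τ δ := by
  sorry

/-- **STUB 4 — TANGENTIAL TOWER EMPTINESS in the gap (OPEN; the hardest stub; the lead's).**
No `(ξ, η) ∉ ℚ̄²`, `η ≠ 0`, carries two-sided absorbed links with `0 < δ ≤ δ_R`.  Status: at least
the crux's open content; consistent with every landed Negative lemma (module docstring); supported
by orbit counting for every `1 < τ < 2` (AnalysisIdeator6 F7); NOT within reach of any ≤2-point
Diophantine statement for `τ < 3/2` (card W3).  Structure a prover gets for free from the
hypothesis: `D* ≤ (3C²)^{1/(τ−1)} D^{1−δ/(τ−1)}` (`IsLink.rpow_Ds_le`), saturation dichotomy,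
mortality of every fixed link, Northcott for bounded `D*`.  Honest sub-targets: bounded-degree
links (uniform linear Hermite–Lindemann measure), the slice `τ ≥ 7/4` under a counting-consistent
pair measure, the sole-server epoch configuration (TRIAGE-r2-1 (Q2)).
[cite: Roy2013, §7 Step 5; card two-sided-absorption-transfer Transfer/F7] -/
theorem stub_tangentialTowerEmptiness : TangentialTowerEmptiness := by
  sorry

/-! ## §2 Composition (sorry-free): the crux from the five stubs -/

/-- **Enemy links from the small-value hypothesis** (stubs 1a + 1b). -/
theorem hasLinks_of_smallValueHyp (ξ η : ℂ) (hη : η ≠ 0) (hna : ¬(IsAlgebraic ℚ ξ ∧ IsAlgebraic ℚ η))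
    (β τ δ : ℝ) (h1 : 1 < τ) (h2 : τ < 2) (hβ : τ < β) (hδ : 0 < δ)
    (hP : SmallValueHyp ξ η β τ (2 + β - τ + δ)) : HasLinks ξ η β τ δ :=
  stub_linksOfOrbits ξ η β τ δ (stub_enemyOrbits ξ η hη hna β τ δ h1 h2 hβ hδ hP)

/-- **The crux from the line** — the ONLY theorem of this file concluding
`Summit.Schanuel.Schanuel.Theses.RoyCriterion.RoySmallValueDirichletGap`, BY NAME; no hypotheses;
the registered stubs are invoked (sorries live only in `stub_*`).  `τ = 1`: Roy's theorem
(the correction term vanishes).  `1 < τ`: with `δ := ν − (2+β−τ) > 0` and `γ ∉ ℚ̄²` (by contradiction),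
stubs 1a/1b give links; `δ > δ_R` is absurd by stub 3; else stub 2 absorbs every link two-sidedly
and stub 4 concludes `γ ∈ ℚ̄²`. -/
theorem RoySmallValueDirichletGap_of : RoySmallValueDirichletGap := by
  intro ξ η hη β τ ν h1 h2 hβ hν hP
  rcases h1.eq_or_lt with h1 | h1
  · -- τ = 1 : Roy 2013, Theorem 1.1 (the gap is empty)
    subst h1
    refine Literature.NumberTheory.Transcendental.roy2013_thm_1_1_holds ξ η hη β 1 ν le_rfl h2 hβ ?_ hP
    have h0 : ((1 : ℝ) - 1) * (2 - 1) / (β + 1 - 1) = 0 := by simp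
    linarith [h0]
  · by_contra hna
    obtain ⟨δ, hδdef⟩ : ∃ δ : ℝ, δ = ν - (2 + β - τ) := ⟨_, rfl⟩
    have hδ : 0 < δ := by rw [hδdef]; linarith
    have hP' : SmallValueHyp ξ η β τ (2 + β - τ + δ) := by
      have hν' : 2 + β - τ + δ = ν := by rw [hδdef]; ring
      rw [hν']
      exact hP
    obtain ⟨C, hC, hL⟩ := hasLinks_of_smallValueHyp ξ η hη hna β τ δ h1 h2 hβ hδ hP'
    rcases lt_or_ge ((τ - 1) * (2 - τ) / (β + 1 - τ)) δ with hR | hR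
    · exact stub_royRegime ξ η β τ δ h1 h2 hβ hR ⟨C, hC, hL⟩
    · obtain ⟨c, hc, hA⟩ := stub_twoSidedAbsorption ξ η β τ δ C h1 h2 hβ hδ hC
      refine hna (stub_tangentialTowerEmptiness ξ η hη β τ δ h1 h2 hβ hδ hR ⟨C, c, hC, hc, ?_⟩)
      filter_upwards [hL, hA] with D hLD hAD
      obtain ⟨P, h, Ds, hlink⟩ := hLD
      exact ⟨P, h, Ds, hlink, hAD P h Ds hlink⟩

/-! ## §3 Consistency with the landed Negative lemmas (read-back; no new content) -/

/-- `η ≠ 0` is load-bearing (landed). -/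
example := @Summit.Schanuel.Schanuel.Theorems.roySmallValueDirichletGap_false_without_etaNeZero
/-- `1 ≤ τ` is load-bearing (landed). -/
example := @Summit.Schanuel.Schanuel.Theorems.RoySmallValueDirichletGapTauCount.roySmallValueDirichletGap_false_without_oneLeTau
/-- the Dirichlet edge (landed). -/
example := @Summit.Schanuel.Schanuel.Theorems.RoySmallValueDirichletGapDirichlet.roySmallValueDirichletGap_false_below_edge
/-- uniformity in `D` is load-bearing (landed): our `HasLinks` is an `∀ᶠ D` statement. -/
example := @Summit.Schanuel.Schanuel.Theorems.RoySmallValueDirichletGapFrequently.roySmallValueDirichletGap_false_with_frequently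
/-- open content = gap case (landed); stubs 3/4 split exactly along `δ_R`. -/
example := @Summit.Schanuel.Schanuel.Theorems.RoySmallValueDirichletGapGap.roySmallValueDirichletGap_iff_gap

end Summit.Schanuel.Schanuel.Theorems.RoyLinks

end
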